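import Literature.Analysis.FluidPDE.FracNSGalerkinLimitField
import HarnessLib

/-!
# Fractional Navier–Stokes on `T^d`: energy inequalities and the energy class of the limit of a
  fractional Galerkin scheme (proof of the named fact `fracGalerkin_limit`, part 3)

Analysis/FluidPDE. Third module of the proof of the named fact
`Literature.Analysis.FluidPDE.fracGalerkin_limit` (`Literature/Analysis/FluidPDE/FracNSGalerkin`;
Colombo–De Lellis–De Rosa 2018, §1 (2)–(3) and §9: the Leray solution obtained as the limit of the
Galerkin approximations obeys `½∫|v(t)|² + ∫₀ᵗ∫|(-Δ)^{α/2}v|² ≤ ½∫|v̄|²` for every `t` and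
`½∫|v(t)|² + ∫ₛᵗ∫|(-Δ)^{α/2}v|² ≤ ½∫|v(s)|²` for a.e. `s` and every `t > s`; "in the sequel we
will always assume that `v` … is weakly continuous in time and that (2) holds for every `t`"),
continuing `FracNSGalerkinLimitField` and following the tree's `α = 1` module `NSHopfEnergy`
(lower semicontinuity on the Fourier side). For a fractional Galerkin scheme `(N, U)` and a field
`u` with `L²` slices to which the approximations converge coefficientwise at every time:

* **the energy inequality of the limit from every time `s` at which `U n s → u s` strongly**
  (`IsFracGalerkinScheme.energy_ineq_limit_of_tendsto`): partial sums over finitely many Fourier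
  modes of `½‖U n t‖²` and of `∫ₛᵗ ∑ σ_α(k)‖Û_n(τ,k)‖²` are bounded by the exact Galerkin energy
  identity and converge; then the modes are exhausted (monotone convergence) — hence the energy
  inequality **from `0` for every `t ≥ 0`** (`U n 0 → u₀` strongly) and **from a.e. `s`** along
  a further subsequence with `U n s → u s` for a.e. `s` (Friedrichs);
* the same inequalities in the `[0, ∞]`-valued form of `Torus.IsLerayFracSolution`
  (`2⁻¹ * eL2NormSq (u t) + ∫⁻ D_α ≤ 2⁻¹ * eL2NormSq (u s)`);
* the **energy class**: `∫⁻‖u t‖ₑ² ≤ ofReal ∫‖u₀‖²` for all `t ≥ 0`, and `u ∈ L²(0,T; H^α)`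
  (`Torus.MemL2Sobolev 0 T α`, via `Torus.eSobolevNorm_sq_le_add_eFracDissipation`).

Theorem-only module.

## References

* M. Colombo, C. De Lellis, L. De Rosa, *Ill-posedness of Leray solutions for the hypodissipative
  Navier–Stokes equations*, Comm. Math. Phys. 362 (2018), §1 Thm. 1.1, (2)–(3); §9.
  [`ColomboDelellisDerosa2018`]
* J. C. Robinson, J. L. Rodrigo, W. Sadowski, *The three-dimensional Navier–Stokes equations*
  (CUP 2016), Thm. 4.4 Step 4 (4.17)–(4.19), Lemma 4.5, Thm. 4.6 (the `α = 1` template).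
  [`RobinsonRodrigoSadowski2016`]
-/

noncomputable section

open MeasureTheory TopologicalSpace Set Function Filter Topology UnitAddTorus
open scoped InnerProductSpace RealInnerProductSpace ENNReal NNReal

namespace Literature.Analysis.FluidPDE

variable {d : Type*} [Fintype d] [DecidableEq d]

variable {α : ℝ} {u₀ : UnitAddTorus d → EuclideanSpace ℝ d} {N : ℕ → ℕ}
  {U : ℕ → ℝ → UnitAddTorus d → EuclideanSpace ℝ d}
  {u : ℝ → UnitAddTorus d → EuclideanSpace ℝ d}

/-! ## Partial dissipation sums of the approximations -/

section PartialDissipation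

/-- The partial fractional dissipation integrands of the Galerkin approximations
`τ ↦ ∑_{k∈S} σ_α(k) ‖Û_n(τ,k)‖²` are continuous on `[0, ∞)`. [folklore] -/
theorem IsFracGalerkinScheme.continuousOn_fracDissipation_sum (hS : IsFracGalerkinScheme α u₀ N U)
    (n : ℕ) (S : Finset (d → ℤ)) :
    ContinuousOn (fun τ => ∑ k ∈ S, Torus.fracSymbol α k *
      ‖mFourierCoeff (FunctionSpaces.EuclideanSpace.complexify ∘ U n τ) k‖ ^ 2) (Ici 0) :=
  continuousOn_finsetSum _ fun k _ => continuousOn_const.mul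
    ((FunctionSpaces.Torus.continuousOn_mFourierCoeff_of_continuousOn_stLift (hS.continuousOn n) k).norm.pow 2)

/-- **Partial dissipation is bounded by the dissipation** of a Galerkin approximation:
`∫ₛᵗ ∑_{k∈S} σ_α(k) ‖Û_n(τ,k)‖² dτ ≤ (∫⁻_{(s,t)} D_α(U n))‖.toReal` for `0 ≤ s ≤ t`, `α ≠ 0`. [folklore] -/
theorem IsFracGalerkinScheme.intervalIntegral_fracDissipation_sum_le
    (hS : IsFracGalerkinScheme α u₀ N U) (hα : α ≠ 0) (hu₀ : MemLp u₀ 2 volume) (n : ℕ)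
    (S : Finset (d → ℤ)) {s t : ℝ} (hs : 0 ≤ s) (hst : s ≤ t) :
    ∫ τ in s..t, (∑ k ∈ S, Torus.fracSymbol α k *
        ‖mFourierCoeff (FunctionSpaces.EuclideanSpace.complexify ∘ U n τ) k‖ ^ 2) ≤
      (∫⁻ τ in Ioo s t, Torus.eFracDissipation α (U n τ)).toReal := by
  rw [Torus.intervalIntegral_eq_toReal_lintegral hst
    ((hS.continuousOn_fracDissipation_sum n S).mono fun τ hτ => mem_Ici.2 (hs.trans hτ.1))
    (fun τ _ => Finset.sum_nonneg fun k _ => mul_nonneg (Torus.fracSymbol_nonneg α k) (sq_nonneg _))]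
  have hfin : ∫⁻ τ in Ioo s t, Torus.eFracDissipation α (U n τ) ≠ ⊤ :=
    (lt_of_le_of_lt (lintegral_mono_set (Ioo_subset_Ioo_left hs))
      (hS.lintegral_eFracDissipation_lt_top hα hu₀ n t)).ne
  exact ENNReal.toReal_mono hfin (lintegral_mono fun τ =>
    Torus.ofReal_fracDissipation_sum_le hα (U n τ) S)

/-- **The partial dissipation integrals converge** as `n → ∞`, for every finite set of modes and
`0 ≤ s ≤ t` (dominated convergence: the integrands converge for every `τ` and are bounded by
`∑_{k∈S} σ_α(k) · ∫‖u₀‖²`). [folklore] -/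
theorem IsFracGalerkinScheme.tendsto_intervalIntegral_fracDissipation_sum
    (hS : IsFracGalerkinScheme α u₀ N U) (hu₀ : MemLp u₀ 2 volume)
    (hc : ∀ t, 0 ≤ t → ∀ k, Tendsto (fun n => mFourierCoeff (FunctionSpaces.EuclideanSpace.complexify ∘ U n t) k)
      atTop (𝓝 (mFourierCoeff (FunctionSpaces.EuclideanSpace.complexify ∘ u t) k)))
    (S : Finset (d → ℤ)) {s t : ℝ} (hs : 0 ≤ s) (hst : s ≤ t) :
    Tendsto (fun n => ∫ τ in s..t, (∑ k ∈ S, Torus.fracSymbol α k *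
        ‖mFourierCoeff (FunctionSpaces.EuclideanSpace.complexify ∘ U n τ) k‖ ^ 2)) atTop
      (𝓝 (∫ τ in s..t, (∑ k ∈ S, Torus.fracSymbol α k *
        ‖mFourierCoeff (FunctionSpaces.EuclideanSpace.complexify ∘ u τ) k‖ ^ 2))) := by
  obtain ⟨Y, hYdef⟩ : ∃ Y : ℝ, Y = ∫ x, ‖u₀ x‖ ^ 2 := ⟨_, rfl⟩
  have hYn : ∀ n τ, 0 ≤ τ → ∫ x, ‖U n τ x‖ ^ 2 ≤ Y := fun n τ hτ => by
    rw [hYdef]; exact hS.integral_norm_sq_le hu₀ n hτ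
  refine intervalIntegral.tendsto_integral_filter_of_dominated_convergence
    (fun _ => ∑ k ∈ S, Torus.fracSymbol α k * Y) ?_ ?_ intervalIntegrable_const ?_
  · refine Eventually.of_forall fun n => ?_
    rw [uIoc_of_le hst]
    exact ((hS.continuousOn_fracDissipation_sum n S).mono
      fun τ hτ => mem_Ici.2 (hs.trans hτ.1.le)).aestronglyMeasurable measurableSet_Ioc
  · refine Eventually.of_forall fun n => ae_of_all _ fun τ hτ => ?_
    rw [uIoc_of_le hst] at hτ
    have hτ0 : 0 ≤ τ := hs.trans hτ.1.le
    have hnn : 0 ≤ ∑ k ∈ S, Torus.fracSymbol α k *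
        ‖mFourierCoeff (FunctionSpaces.EuclideanSpace.complexify ∘ U n τ) k‖ ^ 2 :=
      Finset.sum_nonneg fun k _ => mul_nonneg (Torus.fracSymbol_nonneg α k) (sq_nonneg _)
    rw [Real.norm_eq_abs, abs_of_nonneg hnn]
    refine Finset.sum_le_sum fun k _ => ?_
    exact mul_le_mul_of_nonneg_left ((hS.norm_mFourierCoeff_sq_le n hτ0 k).trans (hYn n τ hτ0))
      (Torus.fracSymbol_nonneg α k)
  · refine ae_of_all _ fun τ hτ => ?_
    rw [uIoc_of_le hst] at hτ
    have hτ0 : 0 ≤ τ := hs.trans hτ.1.le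
    exact tendsto_finsetSum _ fun k _ => ((hc τ hτ0 k).norm.pow 2).const_mul _

end PartialDissipation

/-! ## The energy inequality of the limit -/

section EnergyIneq

/-- **The energy inequality of the limit from every time of strong convergence**
(CDLDR 2018, §1 (3) for the Leray solution of Thm. 1.1; the `α = 1` template is
Robinson–Rodrigo–Sadowski 2016, Thm. 4.6 via Lemma 4.5 and (4.17)–(4.19)). Let `α ≠ 0` and let the
approximations converge coefficientwise at every time to `u` (`hc`); if at the time `s ≥ 0`
moreover `U n s → u s` strongly in `L²`, then for every `t ≥ s`
`½‖u t‖² + ∫ₛᵗ D_α(u) ≤ ½‖u s‖²`.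
Proof: for every finite set of modes, `½ ∑ ‖Û_n(t,k)‖² + ∫ₛᵗ ∑ σ_α(k) ‖Û_n(τ,k)‖²` is at most the
left-hand side of the exact energy identity of `U n`, i.e. `½‖U n s‖²`; let `n → ∞` (finite sums;
dominated convergence in `τ`; strong convergence at `s`), then exhaust the modes (Parseval at
time `t`, monotone convergence in `τ`). [cite: ColomboDelellisDerosa2018, §1 (3) and §9] -/
theorem IsFracGalerkinScheme.energy_ineq_limit_of_tendsto (hS : IsFracGalerkinScheme α u₀ N U)
    (hα : α ≠ 0) (hu₀ : MemLp u₀ 2 volume)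
    (hum : AEStronglyMeasurable (FunctionSpaces.Torus.stLift u) (volume.restrict (Ioi 0 ×ˢ univ)))
    (hu : ∀ t, 0 ≤ t → MemLp (u t) 2 volume)
    (hc : ∀ t, 0 ≤ t → ∀ k, Tendsto (fun n => mFourierCoeff (FunctionSpaces.EuclideanSpace.complexify ∘ U n t) k)
      atTop (𝓝 (mFourierCoeff (FunctionSpaces.EuclideanSpace.complexify ∘ u t) k)))
    {s : ℝ} (hs : 0 ≤ s)
    (hsconv : Tendsto (fun n => eLpNorm (U n s - u s) 2 volume) atTop (𝓝 0)) {t : ℝ} (ht : s ≤ t) :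
    FunctionSpaces.Torus.kineticEnergy (u t) + (∫⁻ τ in Ioo s t, Torus.eFracDissipation α (u τ)).toReal ≤
      FunctionSpaces.Torus.kineticEnergy (u s) := by
  have ht0 : 0 ≤ t := hs.trans ht
  -- right-hand sides converge
  have hR : Tendsto (fun n => FunctionSpaces.Torus.kineticEnergy (U n s)) atTop (𝓝 (FunctionSpaces.Torus.kineticEnergy (u s))) :=
    (Torus.tendsto_integral_norm_sq_of_tendsto_eLpNorm_sub (fun n => hS.memLp_slice n hs)
      (hu s hs) hsconv).const_mul 2⁻¹
  -- the truncated inequality for the approximations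
  have hineq : ∀ (M n : ℕ),
      2⁻¹ * (∑ k ∈ FunctionSpaces.Torus.freqBall M, ‖mFourierCoeff (FunctionSpaces.EuclideanSpace.complexify ∘ U n t) k‖ ^ 2) +
        ∫ τ in s..t, (∑ k ∈ FunctionSpaces.Torus.freqBall M, Torus.fracSymbol α k *
          ‖mFourierCoeff (FunctionSpaces.EuclideanSpace.complexify ∘ U n τ) k‖ ^ 2) ≤
      FunctionSpaces.Torus.kineticEnergy (U n s) := by
    intro M n
    have h1 := Torus.sum_norm_sq_mFourierCoeff_le_integral (hS.memLp_slice n ht0) (FunctionSpaces.Torus.freqBall M)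
    have h2 := hS.intervalIntegral_fracDissipation_sum_le hα hu₀ n (FunctionSpaces.Torus.freqBall M) hs ht
    have h3 := hS.energy_eq n s t hs ht
    unfold FunctionSpaces.Torus.kineticEnergy at h3 ⊢
    nlinarith
  -- `n → ∞` for each `M`
  have hlimM : ∀ M : ℕ,
      2⁻¹ * (∑ k ∈ FunctionSpaces.Torus.freqBall M, ‖mFourierCoeff (FunctionSpaces.EuclideanSpace.complexify ∘ u t) k‖ ^ 2) +
        ∫ τ in s..t, (∑ k ∈ FunctionSpaces.Torus.freqBall M, Torus.fracSymbol α k *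
          ‖mFourierCoeff (FunctionSpaces.EuclideanSpace.complexify ∘ u τ) k‖ ^ 2) ≤
      FunctionSpaces.Torus.kineticEnergy (u s) := by
    intro M
    refine le_of_tendsto_of_tendsto' (Tendsto.add ?_ ?_) hR (hineq M)
    · exact (tendsto_finsetSum _ fun k _ => (hc t ht0 k).norm.pow 2).const_mul _
    · exact hS.tendsto_intervalIntegral_fracDissipation_sum hu₀ hc (FunctionSpaces.Torus.freqBall M) hs ht
  -- `M → ∞`
  have hA : Tendsto (fun M : ℕ => 2⁻¹ * ∑ k ∈ FunctionSpaces.Torus.freqBall M,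
      ‖mFourierCoeff (FunctionSpaces.EuclideanSpace.complexify ∘ u t) k‖ ^ 2) atTop
      (𝓝 (FunctionSpaces.Torus.kineticEnergy (u t))) :=
    ((FunctionSpaces.Torus.hasSum_sq_norm_mFourierCoeff_complexify (hu t ht0)).comp
      FunctionSpaces.Torus.tendsto_freqBall_atTop).const_mul _
  have hB : Tendsto (fun M : ℕ => ∫ τ in s..t, (∑ k ∈ FunctionSpaces.Torus.freqBall M, Torus.fracSymbol α k *
        ‖mFourierCoeff (FunctionSpaces.EuclideanSpace.complexify ∘ u τ) k‖ ^ 2)) atTop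
      (𝓝 ((∫⁻ τ in Ioo s t, Torus.eFracDissipation α (u τ)).toReal)) := by
    -- continuity of the limit integrands, conversion to `lintegral`s
    have hcont : ∀ M : ℕ, ContinuousOn (fun τ => ∑ k ∈ FunctionSpaces.Torus.freqBall M, Torus.fracSymbol α k *
        ‖mFourierCoeff (FunctionSpaces.EuclideanSpace.complexify ∘ u τ) k‖ ^ 2) (Icc s t) :=
      fun M => (continuousOn_finsetSum _ fun k _ => continuousOn_const.mul
        ((hS.continuousOn_mFourierCoeff_limit hu₀ hc k).norm.pow 2)).mono
          fun τ hτ => mem_Ici.2 (hs.trans hτ.1)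
    have heq : ∀ M : ℕ, ∫ τ in s..t, (∑ k ∈ FunctionSpaces.Torus.freqBall M, Torus.fracSymbol α k *
        ‖mFourierCoeff (FunctionSpaces.EuclideanSpace.complexify ∘ u τ) k‖ ^ 2) =
        (∫⁻ τ in Ioo s t, ∑ k ∈ FunctionSpaces.Torus.freqBall M, ENNReal.ofReal (Torus.fracSymbol α k) *
            ‖mFourierCoeff (FunctionSpaces.EuclideanSpace.complexify ∘ u τ) k‖ₑ ^ 2).toReal := by
      intro M
      rw [Torus.intervalIntegral_eq_toReal_lintegral ht (hcont M) (fun τ _ =>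
        Finset.sum_nonneg fun k _ => mul_nonneg (Torus.fracSymbol_nonneg α k) (sq_nonneg _))]
      congr 1
      refine lintegral_congr fun τ => ?_
      exact Torus.ofReal_fracDissipation_sum_eq α _ _
    simp_rw [heq]
    have hfin : ∫⁻ τ in Ioo s t, Torus.eFracDissipation α (u τ) ≠ ⊤ :=
      (lt_of_le_of_lt (lintegral_mono_set (Ioo_subset_Ioo_left hs))
        (hS.lintegral_eFracDissipation_limit_lt_top hα hu₀ hc t)).ne
    refine (ENNReal.tendsto_toReal hfin).comp ?_
    -- monotone convergence in `τ`
    refine lintegral_tendsto_of_tendsto_of_monotone (fun M => ?_) (ae_of_all _ fun τ => ?_)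
      (ae_of_all _ fun τ => ?_)
    · refine Finset.aemeasurable_fun_sum _ fun k _ => ?_
      refine ((AEStronglyMeasurable.enorm ?_).pow_const 2).const_mul _
      exact (FunctionSpaces.Torus.aestronglyMeasurable_mFourierCoeff_stSlice hum t k).mono_measure
        (Measure.restrict_mono (Ioo_subset_Ioo_left hs) le_rfl)
    · intro M M' hMM'
      exact Finset.sum_le_sum_of_subset (FunctionSpaces.Torus.freqBall_mono hMM')
    · rw [Torus.eFracDissipation_eq_tsum_of_ne_zero hα (u τ)]
      exact ENNReal.summable.hasSum.comp FunctionSpaces.Torus.tendsto_freqBall_atTop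
  exact le_of_tendsto' (hA.add hB) hlimM

/-- **Energy inequality of the limit from time `0`, for every `t ≥ 0`** (CDLDR 2018, §1 (2):
`½∫|v|²(t) + ∫₀ᵗ∫|(-Δ)^{α/2}v|² ≤ ½∫|v̄|²`; `U n 0 = P_{N n} u₀ → u₀ = u 0` strongly).
[cite: ColomboDelellisDerosa2018, §1 (2) and §9] -/
theorem IsFracGalerkinScheme.energy_ineq_zero_limit (hS : IsFracGalerkinScheme α u₀ N U)
    (hα : α ≠ 0) (hu₀ : MemLp u₀ 2 volume) (hdiv : FunctionSpaces.Torus.IsWeaklyDivFree u₀)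
    (hum : AEStronglyMeasurable (FunctionSpaces.Torus.stLift u) (volume.restrict (Ioi 0 ×ˢ univ)))
    (hu : ∀ t, 0 ≤ t → MemLp (u t) 2 volume)
    (hc : ∀ t, 0 ≤ t → ∀ k, Tendsto (fun n => mFourierCoeff (FunctionSpaces.EuclideanSpace.complexify ∘ U n t) k)
      atTop (𝓝 (mFourierCoeff (FunctionSpaces.EuclideanSpace.complexify ∘ u t) k))) {t : ℝ} (ht : 0 ≤ t) :
    FunctionSpaces.Torus.kineticEnergy (u t) + (∫⁻ τ in Ioo 0 t, Torus.eFracDissipation α (u τ)).toReal ≤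
      FunctionSpaces.Torus.kineticEnergy u₀ := by
  have hsconv : Tendsto (fun n => eLpNorm (U n 0 - u 0) 2 volume) atTop (𝓝 0) := by
    refine hS.tendsto_initial.congr fun n => eLpNorm_congr_ae ?_
    filter_upwards [hS.limit_zero_ae_eq hu₀ hdiv hu hc] with x hx
    simp [hx]
  rw [← hS.kineticEnergy_limit_zero hu₀ hdiv hu hc]
  exact hS.energy_ineq_limit_of_tendsto hα hu₀ hum hu hc le_rfl hsconv ht

/-- **Energy inequality of the limit from almost every time** (the *strong energy inequality*
(3) of CDLDR 2018, §1: "for a.a. `s ≥ 0` and every `t > s`"; `α > 0`): for every `T`, for a.e.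
`s ∈ (0, T)` and every `t ≥ s`, `½‖u t‖² + ∫ₛᵗ D_α(u) ≤ ½‖u s‖²`. Proof: by Friedrichs
(`tendsto_lintegral_enorm_sub_sq`), `∫₀ᵀ ‖U n s - u s‖²_{L²} ds → 0`, so along a fast subsequence
`U n s → u s` in `L²` for a.e. `s ∈ (0,T)`; apply `energy_ineq_limit_of_tendsto` to the reindexed
scheme. [cite: ColomboDelellisDerosa2018, §1 (3) and §9] -/
theorem IsFracGalerkinScheme.energy_ineq_ae_limit (hS : IsFracGalerkinScheme α u₀ N U)
    (hα : 0 < α) (hu₀ : MemLp u₀ 2 volume)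
    (hum : AEStronglyMeasurable (FunctionSpaces.Torus.stLift u) (volume.restrict (Ioi 0 ×ˢ univ)))
    (hu : ∀ t, 0 ≤ t → MemLp (u t) 2 volume)
    (hc : ∀ t, 0 ≤ t → ∀ k, Tendsto (fun n => mFourierCoeff (FunctionSpaces.EuclideanSpace.complexify ∘ U n t) k)
      atTop (𝓝 (mFourierCoeff (FunctionSpaces.EuclideanSpace.complexify ∘ u t) k))) (T : ℝ) :
    ∀ᵐ s ∂(volume.restrict (Ioo 0 T)), ∀ t, s ≤ t →
      FunctionSpaces.Torus.kineticEnergy (u t) + (∫⁻ τ in Ioo s t, Torus.eFracDissipation α (u τ)).toReal ≤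
        FunctionSpaces.Torus.kineticEnergy (u s) := by
  have hZ := hS.tendsto_lintegral_enorm_sub_sq hα hu₀ hum hu hc T
  -- a fast subsequence
  have hev : ∀ j : ℕ, ∃ M, ∀ n ≥ M,
      ∫⁻ τ in Ioo 0 T, ∫⁻ x, ‖U n τ x - u τ x‖ₑ ^ 2 ≤ (2⁻¹ : ℝ≥0∞) ^ j := fun j =>
    eventually_atTop.1 (ENNReal.tendsto_nhds_zero.1 hZ _ (ENNReal.pow_pos (by norm_num) j))
  obtain ⟨φ, hφ, hφb⟩ := extraction_forall_of_eventually' hev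
  have hGm : ∀ j, AEMeasurable (fun τ => ∫⁻ x, ‖U (φ j) τ x - u τ x‖ₑ ^ 2)
      (volume.restrict (Ioo 0 T)) := fun j =>
    Torus.aemeasurable_lintegral_enorm_sub_sq (hS.aestronglyMeasurable_stLift (φ j)) hum T
  have htsum : ∫⁻ τ in Ioo 0 T, ∑' j, ∫⁻ x, ‖U (φ j) τ x - u τ x‖ₑ ^ 2 ≠ ⊤ := by
    rw [lintegral_tsum hGm]
    refine ne_top_of_le_ne_top ?_ (ENNReal.tsum_le_tsum hφb)
    rw [ENNReal.tsum_geometric, ENNReal.one_sub_inv_two, inv_inv]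
    exact ENNReal.ofNat_ne_top
  have hae : ∀ᵐ τ ∂(volume.restrict (Ioo 0 T)),
      Tendsto (fun j => ∫⁻ x, ‖U (φ j) τ x - u τ x‖ₑ ^ 2) atTop (𝓝 0) := by
    filter_upwards [ae_lt_top' (AEMeasurable.tsum hGm) htsum] with τ hτ
    exact ENNReal.tendsto_atTop_zero_of_tsum_ne_top hτ.ne
  -- the reindexed scheme
  have hS' := hS.comp_strictMono hφ
  have hc' : ∀ t, 0 ≤ t → ∀ k, Tendsto
      (fun j => mFourierCoeff (FunctionSpaces.EuclideanSpace.complexify ∘ (U ∘ φ) j t) k) atTop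
      (𝓝 (mFourierCoeff (FunctionSpaces.EuclideanSpace.complexify ∘ u t) k)) := fun t ht k =>
    (hc t ht k).comp hφ.tendsto_atTop
  filter_upwards [hae, ae_restrict_mem measurableSet_Ioo] with s hs hsI t ht
  have hsconv : Tendsto (fun j => eLpNorm ((U ∘ φ) j s - u s) 2 volume) atTop (𝓝 0) := by
    have h := ((ENNReal.continuous_rpow_const (y := 1 / 2)).tendsto 0).comp hs
    rw [ENNReal.zero_rpow_of_pos (by norm_num)] at h
    refine h.congr fun j => ?_
    rw [Function.comp_apply, Torus.eLpNorm_two_eq_rpow]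
    rfl
  exact hS'.energy_ineq_limit_of_tendsto hα.ne' hu₀ hum hu hc' hsI.1.le hsconv ht

/-- The energy inequality of the limit from almost every time `s > 0` (no upper bound on `s`):
for a.e. `s ∈ (0, ∞)` and every `t ≥ s`, `½‖u t‖² + ∫ₛᵗ D_α(u) ≤ ½‖u s‖²` (countable union of
the statements on `(0, m)`, `m ∈ ℕ`). [cite: ColomboDelellisDerosa2018, §1 (3)] -/
theorem IsFracGalerkinScheme.energy_ineq_ae_Ioi_limit (hS : IsFracGalerkinScheme α u₀ N U)
    (hα : 0 < α) (hu₀ : MemLp u₀ 2 volume)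
    (hum : AEStronglyMeasurable (FunctionSpaces.Torus.stLift u) (volume.restrict (Ioi 0 ×ˢ univ)))
    (hu : ∀ t, 0 ≤ t → MemLp (u t) 2 volume)
    (hc : ∀ t, 0 ≤ t → ∀ k, Tendsto (fun n => mFourierCoeff (FunctionSpaces.EuclideanSpace.complexify ∘ U n t) k)
      atTop (𝓝 (mFourierCoeff (FunctionSpaces.EuclideanSpace.complexify ∘ u t) k))) :
    ∀ᵐ s ∂(volume.restrict (Ioi 0)), ∀ t, s ≤ t →
      FunctionSpaces.Torus.kineticEnergy (u t) + (∫⁻ τ in Ioo s t, Torus.eFracDissipation α (u τ)).toReal ≤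
        FunctionSpaces.Torus.kineticEnergy (u s) := by
  have h : ∀ m : ℕ, ∀ᵐ s ∂(volume.restrict (Ioi (0 : ℝ))), s ∈ Ioo (0 : ℝ) m → ∀ t, s ≤ t →
      FunctionSpaces.Torus.kineticEnergy (u t) + (∫⁻ τ in Ioo s t, Torus.eFracDissipation α (u τ)).toReal ≤
        FunctionSpaces.Torus.kineticEnergy (u s) := by
    intro m
    have h1 := hS.energy_ineq_ae_limit hα hu₀ hum hu hc (m : ℝ)
    rw [ae_restrict_iff' measurableSet_Ioo] at h1
    exact ae_restrict_of_ae h1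
  rw [← ae_all_iff] at h
  filter_upwards [h, ae_restrict_mem measurableSet_Ioi] with s hs hs0 t hst
  obtain ⟨m, hm⟩ := exists_nat_gt s
  exact hs m ⟨hs0, hm⟩ t hst

end EnergyIneq

/-! ## The energy inequalities in `[0, ∞]` -/

section ENNRealForm

omit [DecidableEq d] in
/-- **From the real to the extended form of the energy inequality**: if `v, w ∈ L²`,
`½∫‖v‖² + X.toReal ≤ ½∫‖w‖²` and `X < ∞`, then
`2⁻¹ * eL2NormSq v + X ≤ 2⁻¹ * eL2NormSq w` in `[0, ∞]` (`eL2NormSq = ofReal ∫‖·‖²` on `L²`). [folklore] -/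
theorem Torus.half_eL2NormSq_add_le_of_kineticEnergy_le {v w : UnitAddTorus d → EuclideanSpace ℝ d}
    (hv : MemLp v 2 volume) (hw : MemLp w 2 volume) {X : ℝ≥0∞} (hX : X ≠ ⊤)
    (h : FunctionSpaces.Torus.kineticEnergy v + X.toReal ≤ FunctionSpaces.Torus.kineticEnergy w) :
    2⁻¹ * Torus.eL2NormSq v + X ≤ 2⁻¹ * Torus.eL2NormSq w := by
  unfold FunctionSpaces.Torus.kineticEnergy at h
  rw [Torus.eL2NormSq, Torus.eL2NormSq, Torus.lintegral_enorm_sq_eq_ofReal hv,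
    Torus.lintegral_enorm_sq_eq_ofReal hw, ← ENNReal.ofReal_toReal hX]
  have h2 : (2⁻¹ : ℝ≥0∞) = ENNReal.ofReal 2⁻¹ := by
    rw [ENNReal.ofReal_inv_of_pos two_pos, ENNReal.ofReal_ofNat]
  have hv0 : 0 ≤ ∫ x, ‖v x‖ ^ 2 := integral_nonneg fun x => sq_nonneg _
  have hw0 : 0 ≤ ∫ x, ‖w x‖ ^ 2 := integral_nonneg fun x => sq_nonneg _
  rw [h2, ← ENNReal.ofReal_mul (by norm_num), ← ENNReal.ofReal_mul (by norm_num),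
    ← ENNReal.ofReal_add (by positivity) ENNReal.toReal_nonneg]
  exact ENNReal.ofReal_le_ofReal h

/-- **The energy inequality (2) of CDLDR in `[0, ∞]`**: for every `t ≥ 0`,
`2⁻¹ * eL2NormSq (u t) + ∫⁻_{(0,t)} D_α(u) ≤ 2⁻¹ * eL2NormSq u₀` (`α ≠ 0`).
[cite: ColomboDelellisDerosa2018, §1 (2)] -/
theorem IsFracGalerkinScheme.fracEnergyIneq_zero_limit (hS : IsFracGalerkinScheme α u₀ N U)
    (hα : α ≠ 0) (hu₀ : MemLp u₀ 2 volume) (hdiv : FunctionSpaces.Torus.IsWeaklyDivFree u₀)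
    (hum : AEStronglyMeasurable (FunctionSpaces.Torus.stLift u) (volume.restrict (Ioi 0 ×ˢ univ)))
    (hu : ∀ t, 0 ≤ t → MemLp (u t) 2 volume)
    (hc : ∀ t, 0 ≤ t → ∀ k, Tendsto (fun n => mFourierCoeff (FunctionSpaces.EuclideanSpace.complexify ∘ U n t) k)
      atTop (𝓝 (mFourierCoeff (FunctionSpaces.EuclideanSpace.complexify ∘ u t) k))) {t : ℝ} (ht : 0 ≤ t) :
    2⁻¹ * Torus.eL2NormSq (u t) + ∫⁻ τ in Ioo 0 t, Torus.eFracDissipation α (u τ) ≤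
      2⁻¹ * Torus.eL2NormSq u₀ :=
  Torus.half_eL2NormSq_add_le_of_kineticEnergy_le (hu t ht) hu₀
    (hS.lintegral_eFracDissipation_limit_lt_top hα hu₀ hc t).ne
    (hS.energy_ineq_zero_limit hα hu₀ hdiv hum hu hc ht)

/-- **The energy inequality (3) of CDLDR in `[0, ∞]`**: for a.e. `s > 0` and every `t > s`,
`Torus.FracEnergyIneq α u s t` (`α > 0`). [cite: ColomboDelellisDerosa2018, §1 (3)] -/
theorem IsFracGalerkinScheme.fracEnergyIneq_ae_limit (hS : IsFracGalerkinScheme α u₀ N U)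
    (hα : 0 < α) (hu₀ : MemLp u₀ 2 volume)
    (hum : AEStronglyMeasurable (FunctionSpaces.Torus.stLift u) (volume.restrict (Ioi 0 ×ˢ univ)))
    (hu : ∀ t, 0 ≤ t → MemLp (u t) 2 volume)
    (hc : ∀ t, 0 ≤ t → ∀ k, Tendsto (fun n => mFourierCoeff (FunctionSpaces.EuclideanSpace.complexify ∘ U n t) k)
      atTop (𝓝 (mFourierCoeff (FunctionSpaces.EuclideanSpace.complexify ∘ u t) k))) :
    ∀ᵐ s ∂(volume.restrict (Ioi 0)), ∀ t : ℝ, s < t → Torus.FracEnergyIneq α u s t := by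
  filter_upwards [hS.energy_ineq_ae_Ioi_limit hα hu₀ hum hu hc, ae_restrict_mem measurableSet_Ioi]
    with s hs hs0 t hst
  have hfin : ∫⁻ τ in Ioo s t, Torus.eFracDissipation α (u τ) ≠ ⊤ :=
    (lt_of_le_of_lt (lintegral_mono_set (Ioo_subset_Ioo_left (le_of_lt hs0)))
      (hS.lintegral_eFracDissipation_limit_lt_top hα.ne' hu₀ hc t)).ne
  exact Torus.half_eL2NormSq_add_le_of_kineticEnergy_le (hu t ((le_of_lt hs0).trans hst.le))
    (hu s (le_of_lt hs0)) hfin (hs t hst.le)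

end ENNRealForm

/-! ## The energy class of the limit -/

section EnergyClass

/-- **`L^∞(0,∞; L²)` bound of the limit** in the form of `Torus.IsLerayFracSolution`: there is
`C < ∞` with `eL2NormSq (u t) ≤ C` for a.e. `t > 0` (indeed for every `t ≥ 0`, with
`C = ofReal ∫‖u₀‖²`). [cite: ColomboDelellisDerosa2018, §1 Thm. 1.1 (`v ∈ L^∞(ℝ⁺, L²)`)] -/
theorem IsFracGalerkinScheme.exists_eL2NormSq_limit_le (hS : IsFracGalerkinScheme α u₀ N U)
    (hu₀ : MemLp u₀ 2 volume) (hu : ∀ t, 0 ≤ t → MemLp (u t) 2 volume)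
    (hc : ∀ t, 0 ≤ t → ∀ k, Tendsto (fun n => mFourierCoeff (FunctionSpaces.EuclideanSpace.complexify ∘ U n t) k)
      atTop (𝓝 (mFourierCoeff (FunctionSpaces.EuclideanSpace.complexify ∘ u t) k))) :
    ∃ C : ℝ≥0∞, C < ⊤ ∧ ∀ᵐ t ∂(volume.restrict (Ioi 0)), Torus.eL2NormSq (u t) ≤ C := by
  refine ⟨ENNReal.ofReal (∫ x, ‖u₀ x‖ ^ 2), ENNReal.ofReal_lt_top, ?_⟩
  filter_upwards [ae_restrict_mem measurableSet_Ioi] with t ht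
  exact hS.lintegral_enorm_sq_limit_le hu₀ hu hc (le_of_lt ht)

/-- **The limit lies in `L²(0, T; H^α)`** spectrally for every `T` (the clause of
`Torus.IsLerayFracSolution` reading CDLDR's `v ∈ L²(ℝ⁺, H^α)` locally; `α > 0`): a.e. slice is
in `H^α` and `∫₀ᵀ ‖u‖²_{H^α} < ∞`, from the uniform `L²` bound, the dissipation bound
`∫₀ᵀ D_α(u) ≤ ½∫‖u₀‖²` and `‖·‖²_{H^α} ≤ ‖·‖²_{L²} + D_α` (`Torus.eSobolevNorm_sq_le_add_eFracDissipation`).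
[cite: ColomboDelellisDerosa2018, §1 Thm. 1.1 (`v ∈ L²(ℝ⁺, H^α)`)] -/
theorem IsFracGalerkinScheme.memL2Sobolev_limit (hS : IsFracGalerkinScheme α u₀ N U)
    (hα : 0 < α) (hu₀ : MemLp u₀ 2 volume)
    (hum : AEStronglyMeasurable (FunctionSpaces.Torus.stLift u) (volume.restrict (Ioi 0 ×ˢ univ)))
    (hu : ∀ t, 0 ≤ t → MemLp (u t) 2 volume)
    (hc : ∀ t, 0 ≤ t → ∀ k, Tendsto (fun n => mFourierCoeff (FunctionSpaces.EuclideanSpace.complexify ∘ U n t) k)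
      atTop (𝓝 (mFourierCoeff (FunctionSpaces.EuclideanSpace.complexify ∘ u t) k))) (T : ℝ) :
    FunctionSpaces.Torus.MemL2Sobolev 0 T α (fun t => FunctionSpaces.EuclideanSpace.complexify ∘ u t) := by
  have hL2 : ∀ t ∈ Ioo 0 T, ∫⁻ x, ‖u t x‖ₑ ^ 2 ≤ ENNReal.ofReal (∫ x, ‖u₀ x‖ ^ 2) := fun t ht =>
    hS.lintegral_enorm_sq_limit_le hu₀ hu hc ht.1.le
  have hGfin := hS.lintegral_eFracDissipation_limit_lt_top hα.ne' hu₀ hc T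
  have hGm : AEMeasurable (fun t => Torus.eFracDissipation α (u t)) (volume.restrict (Ioo 0 T)) :=
    Torus.aemeasurable_eFracDissipation_of_coeff
      (fun k => FunctionSpaces.Torus.aestronglyMeasurable_mFourierCoeff_stSlice hum T k) α
  refine ⟨?_, ?_⟩
  · filter_upwards [ae_lt_top' hGm hGfin.ne, ae_restrict_mem measurableSet_Ioo] with t hGt ht
    refine ⟨FunctionSpaces.Torus.integrable_complexify_comp ((hu t ht.1.le).integrable one_le_two), ?_⟩
    have h := Torus.eSobolevNorm_sq_le_add_eFracDissipation hα.le (hu t ht.1.le)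
    have hfin : (∫⁻ x, ‖u t x‖ₑ ^ 2) + Torus.eFracDissipation α (u t) < ⊤ :=
      ENNReal.add_lt_top.2 ⟨lt_of_le_of_lt (hL2 t ht) ENNReal.ofReal_lt_top, hGt⟩
    have h2 : FunctionSpaces.Torus.eSobolevNorm α (FunctionSpaces.EuclideanSpace.complexify ∘ u t) ^ 2 < ⊤ :=
      lt_of_le_of_lt h hfin
    by_contra htop
    rw [not_lt, top_le_iff] at htop
    rw [htop, ENNReal.top_pow two_ne_zero] at h2
    exact lt_irrefl _ h2
  · rw [FunctionSpaces.Torus.eL2SobolevNorm]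
    refine ENNReal.rpow_lt_top_of_nonneg (by norm_num) (lt_top_iff_ne_top.1 ?_)
    calc ∫⁻ t in Ioo 0 T, FunctionSpaces.Torus.eSobolevNorm α (FunctionSpaces.EuclideanSpace.complexify ∘ u t) ^ 2
        ≤ ∫⁻ t in Ioo 0 T, ((∫⁻ x, ‖u t x‖ₑ ^ 2) + Torus.eFracDissipation α (u t)) :=
          setLIntegral_mono' measurableSet_Ioo fun t ht =>
            Torus.eSobolevNorm_sq_le_add_eFracDissipation hα.le (hu t ht.1.le)
      _ ≤ ∫⁻ t in Ioo 0 T, (ENNReal.ofReal (∫ x, ‖u₀ x‖ ^ 2) + Torus.eFracDissipation α (u t)) :=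
          setLIntegral_mono' measurableSet_Ioo fun t ht => add_le_add (hL2 t ht) le_rfl
      _ = (∫⁻ _ in Ioo 0 T, ENNReal.ofReal (∫ x, ‖u₀ x‖ ^ 2)) + ∫⁻ t in Ioo 0 T, Torus.eFracDissipation α (u t) :=
          lintegral_add_left' aemeasurable_const _
      _ < ⊤ := by
          rw [setLIntegral_const]
          exact ENNReal.add_lt_top.2 ⟨ENNReal.mul_lt_top ENNReal.ofReal_lt_top measure_Ioo_lt_top, hGfin⟩

end EnergyClass

end Literature.Analysis.FluidPDE
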